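import Summits.QuantumFields.BalabanUV.Beta.GAN24.WilsonLetterFaceCharge

/-!
# `BalabanUV.Beta.GAN24.FaceChargeCurlResummation` — binder row G-an2-4 ∕ (CONV-C), (S) row of RULING R-gan24p1-g27-1 B (viii), the Ward-type half (W-γ) (p2 g39), PART 7:
# **THE WILSON LETTER's EXIT⊗EXIT CHARGES RESUMMED AGAINST ANY ℓ¹ SLOT 1-FORM `r` = MINUS THE TOTAL CURL OF `r` OVER THE BLOCK-EDGE PLAQUETTES** — so (W-γ) in the
# exit class, channel `(a,b)`, `a ≠ b`, is ONE identity: `Σ_{z : z_a % L = L−1 ∧ (z+e_a)_b % L = L−1} (dr)(a,b,z) = 0` for the defect read-vector `r = v_γ + v_{α⁺}`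
# (pencil `g55/wgamma/WGAMMA-EXIT-PENCIL-v1.md` §3, self-checked exactly; G-an2-4 formalisation swarm → CRUX TEAM (2), seat `b2b-balaban-gan24-formalise-leaf-02`, gen 55)

NOT IN PRINT; OUR BOOKKEEPING ([folklore] lattice exterior calculus: Leibniz for `curv`, `dd = 0` (an2's `AffineAveraging.curv_dz`), the formal adjointness of `curv ∕ curvAdj`
for an ℓ¹ form against a bounded 2-form; PART 6 `WilsonLetterFaceCharge` BY NAME; 0 `def`, 0 cited fact, 0 `def … : Prop`, 0 sorry).  HONEST FRAMING (cell contract,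
verbatim): «discharging `BetaPertH` makes Bałaban's UV stability UNCONDITIONAL — a real constructive-QFT result; it is NOT the continuum limit and NOT the Clay problem.»
HONEST DEPENDENCY (verbatim): «continuum YM on T⁴ ⇐ BetaPertH ∧ nine spine estimates (0/9 proved); BetaPertH ⇐ (D1) ∧ (D4) ∧ CAP+tail; G-an2-4 gates asym, D1 and NE2/3/4.»

* §1 `faceForm_eq_smul_dz` (`a ≠ b`: PART 6's `m_{ab} = 2ψ_a•dzψ_b` as forms), `curv_smul_fun_dz` (Leibniz + `dd = 0`: `curv (f•dzψ) κ l x = df_κ(x)·dzψ_l(x+e_κ) − df_l(x)·dzψ_κ(x+e_l)`),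
  **`curv_faceForm`**: `curv m_{ab} κ l x = 2(dzψ_a κ x·dzψ_b l (x+e_κ) − dzψ_a l x·dzψ_b κ (x+e_l))` — supported on the `(a,b)`-plaquettes at block EDGES.
* §2 `tsum_sum_sum_eq`, `tsum_sub_add_sub`, `tsum_add_sub_sub`, **`tsum_mul_curvAdj_eq_tsum_curv_mul`** — adjointness: for `r` with `∀ κ, Summable |r κ ·|` and a BOUNDED 2-form `F`, `Σ'_u Σ_κ r κ u·(curvAdj F) κ u = Σ'_x Σ_κ Σ_l (curv r) κ l x·F κ l x`.
* §3 `dz_blk_eq_ite`, `abs_dz_blk_le_one`, `abs_curv_faceForm_le`, `sum_sum_curv_mul_curv_faceForm`, **`tsum_sum_mul_faceCharge_wilsonA_eq_neg_tsum_edgeCurl`** — for `a ≠ b`, `1 ≤ L`, `r` ℓ¹: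
  `Σ'_u Σ_κ′ r κ′ u · [Σ'_z exit_b Σ'_x exit_a W κ′ u x z (inl a)(inl b)] = −Σ'_x 𝟙[x_a % L = L−1]·𝟙[x_b % L = L−1]·(curv r) a b x`;
  `tsum_sum_mul_faceCharge_wilsonA_self` — the channel `(b,b)` is `0` for every `r`.
* §4 `summable_abs_dz_of_summable`, **`tsum_sum_mul_faceCharge_wilsonA_eq_zero_of_exact`** (`r = dz λ`, `λ ∈ ℓ¹` ⇒ the resummed exit charge is `0`: `curv ∘ dz = 0`),
  `tsum_dz_eq_zero_of_summable` (the plain-class twin `Σ'_u (dz λ) κ u = 0`).  An EXACT read-vector has slot total `0` AND exit⊗exit charge `0`; exactness of p2's read-vector is NOT asserted.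
Asserts NO value of any read vector; NOTHING of (W-γ)∕(INV)∕(S) claimed; NEVER «G-an2-4 closed» as (CONV-C); NOT D1, NOT `BetaPertH`, NOT continuum, NOT Clay.  2026-08-22.
-/

noncomputable section

open Finset
open scoped BigOperators
open Literature.MathematicalPhysics.QuantumFieldTheory.Balaban1983to89
open Literature.MathematicalPhysics.QuantumFieldTheory.Balaban1983to89.Beta
open StepJetData (wilsonA)
open AffineAveraging (Form1 Form2 dz curv curvAdj curv_dz unitVec unitVec_apply)
open Summit.QuantumFields.BalabanUV.Beta.GAN24.ContactOneGaugeCellAlgebra (affine_unitVec_eq)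
open Summit.QuantumFields.BalabanUV.Beta.GAN24.SymLinKernelFaceSupport (exitFace_eq_dz_blk dz_blk_of_ne)
open Summit.QuantumFields.BalabanUV.Beta.GAN24.WilsonLetterFaceCharge (tsum_exitFace_wilsonA_exitFace_eq_neg_quarter_curvAdj
  tsum_exitFace_wilsonA_exitFace_self)

namespace Summit.QuantumFields.BalabanUV.Beta.GAN24.FaceChargeCurlResummation

variable {d : ℕ}

/-! ## §1 The curvature of PART 6's face form is the wedge of the two coarse-coordinate derivatives -/

/-- [folklore] For `a ≠ b` PART 6's face form is `2ψ_a • dzψ_b`: `dzψ_b β z·(ψ_a z + ψ_a(z+e_β)) = 2ψ_a(z)·dzψ_b β z` (on the `b`-bonds `(z+e_b)_a = z_a`; elsewhere `dzψ_b = 0`). -/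
theorem faceForm_eq_smul_dz {L : ℕ} {a b : Fin (d + 1)} (hab : a ≠ b) (β : Fin (d + 1)) (z : Fin (d + 1) → ℤ) :
    dz (fun w : Fin (d + 1) → ℤ => ((w b / (L : ℤ) : ℤ) : ℝ)) β z
        * ((((z a / (L : ℤ) : ℤ) : ℝ)) + (((z + B6BondElimination.unitVec β) a / (L : ℤ) : ℤ) : ℝ))
      = (2 * (((z a / (L : ℤ) : ℤ) : ℝ))) * dz (fun w : Fin (d + 1) → ℤ => ((w b / (L : ℤ) : ℤ) : ℝ)) β z := by
  by_cases hβ : β = b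
  · subst hβ
    have : (z + B6BondElimination.unitVec β) a = z a := by
      rw [← affine_unitVec_eq]; simp [hab]
    rw [this]; ring
  · rw [dz_blk_of_ne b hβ, zero_mul, mul_zero]

/-- [folklore] **LEIBNIZ + `dd = 0`**: for a 0-form `f` and an EXACT 1-form `dzψ`, `curv (β z ↦ f z·dzψ β z) κ l x = (dz f) κ x·dzψ l (x+e_κ) − (dz f) l x·dzψ κ (x+e_l)`. -/
theorem curv_smul_fun_dz (f ψ : (Fin (d + 1) → ℤ) → ℝ) (κ l : Fin (d + 1)) (x : Fin (d + 1) → ℤ) :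
    curv (fun β z => f z * dz ψ β z) κ l x = dz f κ x * dz ψ l (x + unitVec κ) - dz f l x * dz ψ κ (x + unitVec l) := by
  have h0 : curv (dz ψ) κ l x = 0 := by rw [curv_dz]; rfl
  simp only [AffineAveraging.curv, AffineAveraging.dz] at h0 ⊢
  have e : x + unitVec κ + unitVec l = x + unitVec l + unitVec κ := by abel
  rw [e] at h0 ⊢
  nlinarith [h0]

/-- NOT IN PRINT; OUR BOOKKEEPING.  **THE CURVATURE OF THE FACE FORM** (`a ≠ b`): `curv m_{ab} κ l x = 2·(dzψ_a κ x·dzψ_b l (x+e_κ) − dzψ_a l x·dzψ_b κ (x+e_l))` — the lattice wedge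
`2·dψ_a ∧ dψ_b`, supported on the plaquettes whose `κ`-edge at `x` crosses an `a`-face and whose `l`-edge at `x+e_κ` crosses a `b`-face (block EDGES). -/
theorem curv_faceForm {L : ℕ} {a b : Fin (d + 1)} (hab : a ≠ b) (κ l : Fin (d + 1)) (x : Fin (d + 1) → ℤ) :
    curv (fun β z => dz (fun w : Fin (d + 1) → ℤ => ((w b / (L : ℤ) : ℤ) : ℝ)) β z
        * ((((z a / (L : ℤ) : ℤ) : ℝ)) + (((z + B6BondElimination.unitVec β) a / (L : ℤ) : ℤ) : ℝ))) κ l x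
      = 2 * (dz (fun w : Fin (d + 1) → ℤ => ((w a / (L : ℤ) : ℤ) : ℝ)) κ x * dz (fun w : Fin (d + 1) → ℤ => ((w b / (L : ℤ) : ℤ) : ℝ)) l (x + unitVec κ)
          - dz (fun w : Fin (d + 1) → ℤ => ((w a / (L : ℤ) : ℤ) : ℝ)) l x * dz (fun w : Fin (d + 1) → ℤ => ((w b / (L : ℤ) : ℤ) : ℝ)) κ (x + unitVec l)) := by
  have e : (fun β z => dz (fun w : Fin (d + 1) → ℤ => ((w b / (L : ℤ) : ℤ) : ℝ)) β z
        * ((((z a / (L : ℤ) : ℤ) : ℝ)) + (((z + B6BondElimination.unitVec β) a / (L : ℤ) : ℤ) : ℝ)))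
      = fun β z => (2 * (((z a / (L : ℤ) : ℤ) : ℝ))) * dz (fun w : Fin (d + 1) → ℤ => ((w b / (L : ℤ) : ℤ) : ℝ)) β z := by
    funext β z; exact faceForm_eq_smul_dz hab β z
  rw [e, curv_smul_fun_dz]
  have hd : ∀ (μ : Fin (d + 1)) (y : Fin (d + 1) → ℤ), dz (fun z : Fin (d + 1) → ℤ => 2 * (((z a / (L : ℤ) : ℤ) : ℝ))) μ y
      = 2 * dz (fun w : Fin (d + 1) → ℤ => ((w a / (L : ℤ) : ℤ) : ℝ)) μ y := by
    intro μ y; simp only [AffineAveraging.dz]; ring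
  rw [hd, hd]; ring

/-! ## §2 Adjointness of `curv` and `curvAdj` for an ℓ¹ 1-form against a bounded 2-form -/

/-- [folklore] Fubini for a double finite sum of summable families: `Σ'_u Σ_κ Σ_l G κ l u = Σ_κ Σ_l Σ'_u G κ l u`. -/
theorem tsum_sum_sum_eq {X : Type*} (G : Fin (d + 1) → Fin (d + 1) → X → ℝ) (hG : ∀ κ l, Summable (G κ l)) :
    ∑' u, ∑ κ, ∑ l, G κ l u = ∑ κ, ∑ l, ∑' u, G κ l u := by
  rw [Summable.tsum_finsetSum (fun κ _ => summable_sum fun l _ => hG κ l)]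
  exact Finset.sum_congr rfl fun κ _ => Summable.tsum_finsetSum fun l _ => hG κ l

/-- [folklore] `Σ'(f − g + h − k) = Σ'f − Σ'g + Σ'h − Σ'k` for four summable real families. -/
theorem tsum_sub_add_sub {X : Type*} {f g h k : X → ℝ} (hf : Summable f) (hg : Summable g) (hh : Summable h) (hk : Summable k) :
    ∑' u, (f u - g u + h u - k u) = ∑' u, f u - ∑' u, g u + ∑' u, h u - ∑' u, k u := by
  rw [((hf.sub hg).add hh).tsum_sub hk, (hf.sub hg).tsum_add hh, hf.tsum_sub hg]

/-- [folklore] `Σ'(f + g − h − k) = Σ'f + Σ'g − Σ'h − Σ'k` for four summable real families. -/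
theorem tsum_add_sub_sub {X : Type*} {f g h k : X → ℝ} (hf : Summable f) (hg : Summable g) (hh : Summable h) (hk : Summable k) :
    ∑' u, (f u + g u - h u - k u) = ∑' u, f u + ∑' u, g u - ∑' u, h u - ∑' u, k u := by
  rw [((hf.add hg).sub hh).tsum_sub hk, (hf.add hg).tsum_sub hh, hf.tsum_add hg]

/-- [folklore] **`curvAdj` IS THE FORMAL ADJOINT OF `curv`**: for a 1-form `r` with absolutely summable components and a BOUNDED 2-form `F`,
`Σ'_u Σ_κ r κ u·(curvAdj F) κ u = Σ'_x Σ_κ Σ_l (curv r) κ l x·F κ l x` — expand both sides into the same four families of absolutely convergent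
elementary sums (one lattice shift `u = x + e_l` in the cross pieces, one exchange `κ ↔ l` of the finite indices). -/
theorem tsum_mul_curvAdj_eq_tsum_curv_mul {r : Form1 (d + 1) ℝ} (hr : ∀ κ, Summable fun u => |r κ u|) {F : Form2 (d + 1) ℝ} {B : ℝ}
    (hF : ∀ κ l x, |F κ l x| ≤ B) :
    ∑' u, ∑ κ, r κ u * curvAdj F κ u = ∑' x, ∑ κ, ∑ l, curv r κ l x * F κ l x := by
  -- every elementary piece `u ↦ r κ (u + c) * g u` with `|g| ≤ B` is summable
  have hpiece : ∀ (κ : Fin (d + 1)) (c : Fin (d + 1) → ℤ) (g : (Fin (d + 1) → ℤ) → ℝ), (∀ u, |g u| ≤ B) →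
      Summable fun u => r κ (u + c) * g u := by
    intro κ c g hg
    have hs : Summable fun u => |r κ (u + c)| := (Equiv.addRight c).summable_iff.2 (hr κ)
    refine Summable.of_norm_bounded (hs.mul_right B) (fun u => ?_)
    rw [Real.norm_eq_abs, abs_mul]
    exact mul_le_mul_of_nonneg_left (hg u) (abs_nonneg _)
  have hpiece0 : ∀ (κ : Fin (d + 1)) (g : (Fin (d + 1) → ℤ) → ℝ), (∀ u, |g u| ≤ B) → Summable fun u => r κ u * g u := by
    intro κ g hg; simpa using hpiece κ 0 g hg
  -- the four elementary sums
  have sP : ∀ κ l, Summable fun u => r κ u * F κ l u := fun κ l => hpiece0 κ (fun u => F κ l u) fun u => hF κ l u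
  have sP' : ∀ κ l, Summable fun u => r κ u * F l κ u := fun κ l => hpiece0 κ (fun u => F l κ u) fun u => hF l κ u
  have sQm : ∀ κ l, Summable fun u => r κ u * F κ l (u - unitVec l) := fun κ l => hpiece0 κ _ fun u => hF κ l _
  have sQm' : ∀ κ l, Summable fun u => r κ u * F l κ (u - unitVec l) := fun κ l => hpiece0 κ _ fun u => hF l κ _
  have sQ : ∀ κ l, Summable fun x => r κ (x + unitVec l) * F κ l x := fun κ l => hpiece κ _ (fun x => F κ l x) fun x => hF κ l x
  have sQ' : ∀ κ l, Summable fun x => r κ (x + unitVec l) * F l κ x := fun κ l => hpiece κ _ (fun x => F l κ x) fun x => hF l κ x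
  -- the lattice shift `u = x + e_l`
  have shiftQ : ∀ κ l, ∑' u, r κ u * F κ l (u - unitVec l) = ∑' x, r κ (x + unitVec l) * F κ l x := by
    intro κ l
    rw [← (Equiv.addRight (unitVec l)).tsum_eq (fun u => r κ u * F κ l (u - unitVec l))]
    exact tsum_congr fun x => by simp
  have shiftQ' : ∀ κ l, ∑' u, r κ u * F l κ (u - unitVec l) = ∑' x, r κ (x + unitVec l) * F l κ x := by
    intro κ l
    rw [← (Equiv.addRight (unitVec l)).tsum_eq (fun u => r κ u * F l κ (u - unitVec l))]
    exact tsum_congr fun x => by simp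
  -- expand the left side
  have hL : ∀ u, ∑ κ, r κ u * curvAdj F κ u
      = ∑ κ, ∑ l, (r κ u * F κ l u - r κ u * F κ l (u - unitVec l) + r κ u * F l κ (u - unitVec l) - r κ u * F l κ u) := by
    intro u
    refine Finset.sum_congr rfl fun κ _ => ?_
    simp only [AffineAveraging.curvAdj, Finset.mul_sum, ← Finset.sum_add_distrib]
    refine Finset.sum_congr rfl fun l _ => ?_
    ring
  have hL' : ∑' u, ∑ κ, r κ u * curvAdj F κ u
      = ∑ κ, ∑ l, ((∑' u, r κ u * F κ l u) - (∑' x, r κ (x + unitVec l) * F κ l x)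
          + (∑' x, r κ (x + unitVec l) * F l κ x) - ∑' u, r κ u * F l κ u) := by
    rw [tsum_congr hL, tsum_sum_sum_eq (fun κ l u => r κ u * F κ l u - r κ u * F κ l (u - unitVec l)
      + r κ u * F l κ (u - unitVec l) - r κ u * F l κ u) (fun κ l => (((sP κ l).sub (sQm κ l)).add (sQm' κ l)).sub (sP' κ l))]
    refine Finset.sum_congr rfl fun κ _ => Finset.sum_congr rfl fun l _ => ?_
    rw [tsum_sub_add_sub (sP κ l) (sQm κ l) (sQm' κ l) (sP' κ l), shiftQ, shiftQ']
  -- expand the right side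
  have hR : ∀ x, ∑ κ, ∑ l, curv r κ l x * F κ l x
      = ∑ κ, ∑ l, (r κ x * F κ l x + r l (x + unitVec κ) * F κ l x - r κ (x + unitVec l) * F κ l x - r l x * F κ l x) := by
    intro x
    refine Finset.sum_congr rfl fun κ _ => Finset.sum_congr rfl fun l _ => ?_
    simp only [AffineAveraging.curv]; ring
  have hR' : ∑' x, ∑ κ, ∑ l, curv r κ l x * F κ l x
      = ∑ κ, ∑ l, ((∑' u, r κ u * F κ l u) + (∑' x, r l (x + unitVec κ) * F κ l x)
          - (∑' x, r κ (x + unitVec l) * F κ l x) - ∑' u, r l u * F κ l u) := by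
    rw [tsum_congr hR, tsum_sum_sum_eq (fun κ l x => r κ x * F κ l x + r l (x + unitVec κ) * F κ l x
      - r κ (x + unitVec l) * F κ l x - r l x * F κ l x) (fun κ l => (((sP κ l).add (sQ' l κ)).sub (sQ κ l)).sub (sP' l κ))]
    exact Finset.sum_congr rfl fun κ _ => Finset.sum_congr rfl fun l _ => tsum_add_sub_sub (sP κ l) (sQ' l κ) (sQ κ l) (sP' l κ)
  rw [hL', hR']
  -- exchange `κ ↔ l` in the two cross families
  have hswapA : ∑ κ : Fin (d + 1), ∑ l : Fin (d + 1), (∑' x, r κ (x + unitVec l) * F l κ x)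
      = ∑ κ : Fin (d + 1), ∑ l : Fin (d + 1), (∑' x, r l (x + unitVec κ) * F κ l x) := Finset.sum_comm
  have hswapB : ∑ κ : Fin (d + 1), ∑ l : Fin (d + 1), (∑' u, r κ u * F l κ u)
      = ∑ κ : Fin (d + 1), ∑ l : Fin (d + 1), (∑' u, r l u * F κ l u) := Finset.sum_comm
  simp only [Finset.sum_sub_distrib, Finset.sum_add_distrib] at hswapA hswapB ⊢
  rw [hswapA, hswapB]
  ring

/-! ## §3 The Wilson letter's exit⊗exit charges resummed against an ℓ¹ slot form = minus the edge-plaquette curl total -/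

/-- [folklore] The coarse-coordinate derivative as an indicator: `dzψ_c κ x = 𝟙[κ = c]·𝟙[x_c % L = L−1]` (`1 ≤ L`). -/
theorem dz_blk_eq_ite {L : ℕ} (hL : 1 ≤ L) (c κ : Fin (d + 1)) (x : Fin (d + 1) → ℤ) :
    dz (fun z : Fin (d + 1) → ℤ => ((z c / (L : ℤ) : ℤ) : ℝ)) κ x
      = if κ = c then (if x c % (L : ℤ) = (L : ℤ) - 1 then (1 : ℝ) else 0) else 0 := by
  by_cases hκ : κ = c
  · subst hκ; rw [if_pos rfl, exitFace_eq_dz_blk hL]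
  · rw [if_neg hκ, dz_blk_of_ne c hκ]

/-- [folklore] `|dzψ_c κ x| ≤ 1`. -/
theorem abs_dz_blk_le_one {L : ℕ} (hL : 1 ≤ L) (c κ : Fin (d + 1)) (x : Fin (d + 1) → ℤ) :
    |dz (fun z : Fin (d + 1) → ℤ => ((z c / (L : ℤ) : ℤ) : ℝ)) κ x| ≤ 1 := by
  rw [dz_blk_eq_ite hL]
  split_ifs <;> simp

/-- [folklore] The curvature of the face form is BOUNDED by `4`. -/
theorem abs_curv_faceForm_le {L : ℕ} (hL : 1 ≤ L) {a b : Fin (d + 1)} (hab : a ≠ b) (κ l : Fin (d + 1)) (x : Fin (d + 1) → ℤ) :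
    |curv (fun β z => dz (fun w : Fin (d + 1) → ℤ => ((w b / (L : ℤ) : ℤ) : ℝ)) β z
        * ((((z a / (L : ℤ) : ℤ) : ℝ)) + (((z + B6BondElimination.unitVec β) a / (L : ℤ) : ℤ) : ℝ))) κ l x| ≤ 4 := by
  rw [curv_faceForm hab]
  have h1 := abs_dz_blk_le_one hL a κ x
  have h2 := abs_dz_blk_le_one hL b l (x + unitVec κ)
  have h3 := abs_dz_blk_le_one hL a l x
  have h4 := abs_dz_blk_le_one hL b κ (x + unitVec l)
  have hp1 : |dz (fun z : Fin (d + 1) → ℤ => ((z a / (L : ℤ) : ℤ) : ℝ)) κ x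
      * dz (fun z : Fin (d + 1) → ℤ => ((z b / (L : ℤ) : ℤ) : ℝ)) l (x + unitVec κ)| ≤ 1 := by
    rw [abs_mul]; nlinarith [abs_nonneg (dz (fun z : Fin (d + 1) → ℤ => ((z a / (L : ℤ) : ℤ) : ℝ)) κ x),
      abs_nonneg (dz (fun z : Fin (d + 1) → ℤ => ((z b / (L : ℤ) : ℤ) : ℝ)) l (x + unitVec κ))]
  have hp2 : |dz (fun z : Fin (d + 1) → ℤ => ((z a / (L : ℤ) : ℤ) : ℝ)) l x
      * dz (fun z : Fin (d + 1) → ℤ => ((z b / (L : ℤ) : ℤ) : ℝ)) κ (x + unitVec l)| ≤ 1 := by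
    rw [abs_mul]; nlinarith [abs_nonneg (dz (fun z : Fin (d + 1) → ℤ => ((z a / (L : ℤ) : ℤ) : ℝ)) l x),
      abs_nonneg (dz (fun z : Fin (d + 1) → ℤ => ((z b / (L : ℤ) : ℤ) : ℝ)) κ (x + unitVec l))]
  rw [abs_mul, abs_two]
  have := abs_sub _ _ |>.trans (add_le_add hp1 hp2)
  linarith

/-- [folklore] **THE POINTWISE PAIRING** (`a ≠ b`): `Σ_κ Σ_l (curv r) κ l x·(curv m_{ab}) κ l x = 4·𝟙[x_a % L = L−1]·𝟙[x_b % L = L−1]·(curv r) a b x` — only the index pairs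
`(a,b)` and `(b,a)` meet the wedge `2·dψ_a ∧ dψ_b`, with opposite signs, and `curv r b a = −curv r a b`; `(x+e_a)_b = x_b`. -/
theorem sum_sum_curv_mul_curv_faceForm {L : ℕ} (hL : 1 ≤ L) {a b : Fin (d + 1)} (hab : a ≠ b) (r : Form1 (d + 1) ℝ) (x : Fin (d + 1) → ℤ) :
    ∑ κ, ∑ l, curv r κ l x * curv (fun β z => dz (fun w : Fin (d + 1) → ℤ => ((w b / (L : ℤ) : ℤ) : ℝ)) β z
        * ((((z a / (L : ℤ) : ℤ) : ℝ)) + (((z + B6BondElimination.unitVec β) a / (L : ℤ) : ℤ) : ℝ))) κ l x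
      = 4 * (if x a % (L : ℤ) = (L : ℤ) - 1 then (1 : ℝ) else 0) * (if x b % (L : ℤ) = (L : ℤ) - 1 then (1 : ℝ) else 0) * curv r a b x := by
  -- abbreviations for the two coarse derivatives
  set da : Fin (d + 1) → (Fin (d + 1) → ℤ) → ℝ := dz (fun w : Fin (d + 1) → ℤ => ((w a / (L : ℤ) : ℤ) : ℝ)) with hda
  set db : Fin (d + 1) → (Fin (d + 1) → ℤ) → ℝ := dz (fun w : Fin (d + 1) → ℤ => ((w b / (L : ℤ) : ℤ) : ℝ)) with hdb
  have hcurv : ∀ κ l, curv (fun β z => db β z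
        * ((((z a / (L : ℤ) : ℤ) : ℝ)) + (((z + B6BondElimination.unitVec β) a / (L : ℤ) : ℤ) : ℝ))) κ l x
      = 2 * (da κ x * db l (x + unitVec κ) - da l x * db κ (x + unitVec l)) := fun κ l => curv_faceForm hab κ l x
  have hda0 : ∀ {κ}, κ ≠ a → ∀ y, da κ y = 0 := fun hκ y => dz_blk_of_ne a hκ y
  have hdb0 : ∀ {κ}, κ ≠ b → ∀ y, db κ y = 0 := fun hκ y => dz_blk_of_ne b hκ y
  have hdaa : da a x = (if x a % (L : ℤ) = (L : ℤ) - 1 then (1 : ℝ) else 0) := (exitFace_eq_dz_blk hL a x).symm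
  have hdbb : db b (x + unitVec a) = (if x b % (L : ℤ) = (L : ℤ) - 1 then (1 : ℝ) else 0) := by
    rw [hdb, ← exitFace_eq_dz_blk hL b (x + unitVec a)]
    have : (x + unitVec a) b = x b := by simp [unitVec_apply, hab.symm]
    rw [this]
  simp only [hcurv]
  -- collapse the double sum to the two index pairs `(a,b)` and `(b,a)`
  rw [← Finset.sum_product' (f := fun κ l => curv r κ l x * (2 * (da κ x * db l (x + unitVec κ) - da l x * db κ (x + unitVec l))))]
  have hne : ((a, b) : Fin (d + 1) × Fin (d + 1)) ≠ (b, a) := fun h => hab (Prod.mk.inj h).1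
  rw [Finset.sum_eq_add (s := (Finset.univ : Finset (Fin (d + 1))) ×ˢ (Finset.univ : Finset (Fin (d + 1)))) (a, b) (b, a) hne ?_
    (fun h => (h (by simp)).elim) (fun h => (h (by simp)).elim)]
  · have hanti : curv r b a x = -curv r a b x := by simp only [AffineAveraging.curv]; ring
    simp only
    rw [hdb0 hab (x + unitVec b), hda0 (Ne.symm hab) x, hdaa, hdbb, hanti]
    ring
  · rintro ⟨κ, l⟩ - ⟨h1, h2⟩
    simp only
    by_cases hκa : κ = a
    · subst hκa
      have hlb : l ≠ b := fun h => h1 (by rw [h])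
      rw [hdb0 hlb, hdb0 (by exact hab) (x + unitVec l)]; ring
    · rw [hda0 hκa x]
      by_cases hla : l = a
      · subst hla
        have hκb : κ ≠ b := fun h => h2 (by rw [h])
        rw [hdb0 hκb]; ring
      · rw [hda0 hla x]; ring

/-- NOT IN PRINT; OUR BOOKKEEPING.  **THE RESUMMATION** (`a ≠ b`, `1 ≤ L`, `r` a slot 1-form with absolutely summable components): the exit⊗exit letter charges of the
Wilson cubic, weighted by `r` and summed over all slots, equal MINUS the total curl of `r` over the `(a,b)`-plaquettes at block EDGES:
`Σ'_u Σ_{κ′} r κ′ u·[Σ'_z 𝟙^{exit}_b(z) Σ'_x 𝟙^{exit}_a(x) W(x,z;κ′,u)_{ab}] = −Σ'_x 𝟙[x_a % L = L−1]·𝟙[x_b % L = L−1]·(curv r) a b x`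
(PART 6's `−¼ d*d m_{ab}`, the adjointness of §2 against the bounded `curv m_{ab} = 2·dψ_a ∧ dψ_b`, the pointwise pairing of §3).  So the exit-class reading of (W-γ)
in channel `(a,b)` for a defect read-vector `r` is EXACTLY the vanishing of ONE plaquette-curl total; the value of that total for p2's `v_γ + v_{α⁺}` is NOT asserted here. -/
theorem tsum_sum_mul_faceCharge_wilsonA_eq_neg_tsum_edgeCurl {L : ℕ} (hL : 1 ≤ L) {a b : Fin (d + 1)} (hab : a ≠ b) {r : Form1 (d + 1) ℝ}
    (hr : ∀ κ, Summable fun u => |r κ u|) :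
    ∑' u, ∑ κ', r κ' u * (∑' z, (if z b % (L : ℤ) = (L : ℤ) - 1 then (1 : ℝ) else 0) *
        ∑' x, (if x a % (L : ℤ) = (L : ℤ) - 1 then (1 : ℝ) else 0) * wilsonA d κ' u x z (Sum.inl a) (Sum.inl b))
      = -∑' x, (if x a % (L : ℤ) = (L : ℤ) - 1 then (1 : ℝ) else 0) * (if x b % (L : ℤ) = (L : ℤ) - 1 then (1 : ℝ) else 0) * curv r a b x := by
  have step1 : ∀ u, ∑ κ', r κ' u * (∑' z, (if z b % (L : ℤ) = (L : ℤ) - 1 then (1 : ℝ) else 0) *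
        ∑' x, (if x a % (L : ℤ) = (L : ℤ) - 1 then (1 : ℝ) else 0) * wilsonA d κ' u x z (Sum.inl a) (Sum.inl b))
      = -(1 / 4 : ℝ) * ∑ κ', r κ' u * curvAdj (curv (fun β z => dz (fun w : Fin (d + 1) → ℤ => ((w b / (L : ℤ) : ℤ) : ℝ)) β z
          * ((((z a / (L : ℤ) : ℤ) : ℝ)) + (((z + B6BondElimination.unitVec β) a / (L : ℤ) : ℤ) : ℝ)))) κ' u := by
    intro u
    rw [Finset.mul_sum]
    refine Finset.sum_congr rfl fun κ' _ => ?_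
    rw [tsum_exitFace_wilsonA_exitFace_eq_neg_quarter_curvAdj hL]; ring
  rw [tsum_congr step1, tsum_mul_left, tsum_mul_curvAdj_eq_tsum_curv_mul hr (fun κ l x => abs_curv_faceForm_le hL hab κ l x),
    tsum_congr fun x => sum_sum_curv_mul_curv_faceForm hL hab r x]
  have e4 : (fun x : Fin (d + 1) → ℤ => 4 * (if x a % (L : ℤ) = (L : ℤ) - 1 then (1 : ℝ) else 0)
      * (if x b % (L : ℤ) = (L : ℤ) - 1 then (1 : ℝ) else 0) * curv r a b x)
      = fun x => 4 * ((if x a % (L : ℤ) = (L : ℤ) - 1 then (1 : ℝ) else 0) * (if x b % (L : ℤ) = (L : ℤ) - 1 then (1 : ℝ) else 0) * curv r a b x) := by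
    funext x; ring
  rw [e4, tsum_mul_left]
  ring

/-- NOT IN PRINT; OUR BOOKKEEPING.  The same-direction channel `(b,b)` of the resummation is `0` for EVERY slot form `r` (PART 6: the letter charge itself vanishes). -/
theorem tsum_sum_mul_faceCharge_wilsonA_self {L : ℕ} (hL : 1 ≤ L) (b : Fin (d + 1)) (r : Form1 (d + 1) ℝ) :
    ∑' u, ∑ κ', r κ' u * (∑' z, (if z b % (L : ℤ) = (L : ℤ) - 1 then (1 : ℝ) else 0) *
        ∑' x, (if x b % (L : ℤ) = (L : ℤ) - 1 then (1 : ℝ) else 0) * wilsonA d κ' u x z (Sum.inl b) (Sum.inl b)) = 0 := by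
  have step : ∀ u, ∑ κ', r κ' u * (∑' z, (if z b % (L : ℤ) = (L : ℤ) - 1 then (1 : ℝ) else 0) *
        ∑' x, (if x b % (L : ℤ) = (L : ℤ) - 1 then (1 : ℝ) else 0) * wilsonA d κ' u x z (Sum.inl b) (Sum.inl b)) = 0 := by
    intro u
    exact Finset.sum_eq_zero fun κ' _ => by rw [tsum_exitFace_wilsonA_exitFace_self hL, mul_zero]
  rw [tsum_congr step, tsum_zero]

/-! ## §4 An EXACT read-vector has no exit-class charge (the Ward-type shape: `r = dλ`, `λ` summable) -/

/-- [folklore] The components of an exact slot form `dz λ` with `λ ∈ ℓ¹` are absolutely summable. -/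
theorem summable_abs_dz_of_summable {lam : (Fin (d + 1) → ℤ) → ℝ} (hlam : Summable fun u => |lam u|) (κ : Fin (d + 1)) :
    Summable fun u => |dz lam κ u| := by
  have h1 : Summable fun u => |lam (u + unitVec κ)| := (Equiv.addRight (unitVec κ)).summable_iff.2 hlam
  refine Summable.of_nonneg_of_le (fun u => abs_nonneg _) (fun u => ?_) (h1.add hlam)
  simp only [AffineAveraging.dz]
  exact abs_sub _ _

/-- NOT IN PRINT; OUR BOOKKEEPING.  **AN EXACT READ-VECTOR IS CHARGE-FREE IN THE EXIT CLASS** (`a ≠ b`, `1 ≤ L`): if the slot form is a lattice gradient `r = dz lam` of an ℓ¹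
potential `λ`, then `curv r = 0` pointwise (an2's `curv_dz`), so by §3 the `r`-weighted total of the Wilson letter's exit⊗exit charges VANISHES.  (The plain-class twin —
`Σ'_u (dz lam) κ u = 0` — is the telescoping sum.)  Whether p2's defect read-vector `v_γ + v_{α⁺}` IS exact is NOT asserted here. -/
theorem tsum_sum_mul_faceCharge_wilsonA_eq_zero_of_exact {L : ℕ} (hL : 1 ≤ L) {a b : Fin (d + 1)} (hab : a ≠ b) {lam : (Fin (d + 1) → ℤ) → ℝ}
    (hlam : Summable fun u => |lam u|) :
    ∑' u, ∑ κ', dz lam κ' u * (∑' z, (if z b % (L : ℤ) = (L : ℤ) - 1 then (1 : ℝ) else 0) *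
        ∑' x, (if x a % (L : ℤ) = (L : ℤ) - 1 then (1 : ℝ) else 0) * wilsonA d κ' u x z (Sum.inl a) (Sum.inl b)) = 0 := by
  rw [tsum_sum_mul_faceCharge_wilsonA_eq_neg_tsum_edgeCurl hL hab (summable_abs_dz_of_summable hlam)]
  have h0 : ∀ x, curv (dz lam) a b x = 0 := fun x => by rw [curv_dz]; rfl
  simp only [h0, mul_zero, tsum_zero, neg_zero]

/-- [folklore] The plain-class twin: the slot TOTAL of an exact form with an ℓ¹ potential vanishes, `Σ'_u (dz lam) κ u = 0` (telescoping). -/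
theorem tsum_dz_eq_zero_of_summable {lam : (Fin (d + 1) → ℤ) → ℝ} (hlam : Summable lam) (κ : Fin (d + 1)) :
    ∑' u, dz lam κ u = 0 := by
  have h1 : Summable fun u => lam (u + unitVec κ) := (Equiv.addRight (unitVec κ)).summable_iff.2 hlam
  have e1 : ∑' u, lam (u + unitVec κ) = ∑' u, lam u := (Equiv.addRight (unitVec κ)).tsum_eq lam
  simp only [AffineAveraging.dz]
  rw [h1.tsum_sub hlam, e1, sub_self]

end Summit.QuantumFields.BalabanUV.Beta.GAN24.FaceChargeCurlResummation

end
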